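import Summits.AtomisticToContinuum.Crystallization.Theorems.FrustratedLawDichotomyStrainedPatchHomSlopeLJAffine2Rec

/-!
# K1-v2 kernel, PIECEWISE CERTIFICATION: the second-order slope inequality assembled from separately decided numeric bounds on its five summands
# (27623 `(H) HomFloor (1/625)`, hcp half; hand-1 g34 FINDING §3b)

decomp-a2c hand-1 g34 (crux `AperiodicFrustratedLawGap`, stmt-AtomisticToContinuum-27623).  Kernel measurements (seat probes V1–V7): no single piece of
`…Affine2Rec.htGsSumA2R` exceeds the farm's 600 s, their sum does (`W2` 126 s, `W1` 71 s, `T0` 52 s incl. load; second look-ups nearly free).  This file names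
the quadratic piece `quadL2R` (literally the sub-term of `slopeGsLJA2R`, `slopeGsLJA2R_pieces` by `rfl`-level unfolding) and proves ★ `htGsSumA2R_of_pieces`:
integer bounds `b₀₁ ≥ g0LJ + linLJA`, `b₂ ≥ quadL2R`, `b₃ ≥ rem3LJ`, `b₄ ≥ naiSLJ + htGsNA far₁ + htGsNA far₂` with `b₀₁ + b₂ + b₃ + b₄ ≤ p.Gs` give
`htGsSumA2R p J c w = true` — so the certificate side of `…HomEntryLeafHTA2F` is FIVE kernel facts (`htCertRestA2` + four `decide`s) + `htCertSideA2F_of_parts`.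

Kernel definition + bookkeeping lemma; 0 sorry; standard axioms; no instances / notation / `#eval`.  `--supports stmt-AtomisticToContinuum-27623`.
-/

noncomputable section

namespace Summit.AtomisticToContinuum.Crystallization.Theorems.FrustratedLawDichotomyStrainedPatchHomEntryLeafHT

open Literature.Analysis.ValidatedNumerics.Numerics
open Summit.AtomisticToContinuum.Crystallization.Theorems.FrustratedLawDichotomyStrainedPatchHomSlopeLJ
open Summit.AtomisticToContinuum.Crystallization.Theorems.FrustratedLawDichotomyStrainedPatchHomSlopeLJAffine
open Summit.AtomisticToContinuum.Crystallization.Theorems.FrustratedLawDichotomyStrainedPatchHomSlopeLJAffine2Kit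

/-- The quadratic piece of `slopeGsLJA2R` (tabulated records), as a stand-alone kernel quantity. -/
def quadL2R (c w : (Fin 3 × Fin 3) ⊕ Fin 3 → ℤ) (J : Fin 3 → Fin 3 × Fin 3 → ℤ) (Lc : List (Fin 3 → ℤ)) : ℤ :=
  let rs := recsT c w J Lc
  let t0 := memo3 fun k => memo3 fun k' => memo3 fun i => T0R rs k k' i
  let w1 := memo3 fun l => memo3 fun k => memo3 fun k' => memo3 fun i => W1R rs l k k' i
  let w2 := memo3 fun l => memo3 fun l' => memo3 fun k => memo3 fun k' => memo3 fun i => W2R rs l l' k k' i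
  let qv := fun i => cdiv (∑ a : Fin 3 × Fin 3, ∑ a' : Fin 3 × Fin 3, cdiv (w (Sum.inl a) * w (Sum.inl a')) SC * (QarrT c J t0 w1 w2 i a a').absHi +
    resQR c w J rs i) (2 * SC)
  let q0 := qv 0
  let q1 := qv 1
  let q2 := qv 2
  (FI.sqrt ⟨0, cdiv (q0 ^ 2 + q1 ^ 2 + q2 ^ 2) SC⟩).hi

/-- `slopeGsLJA2R` is the sum of its five named pieces. [formal bookkeeping] -/
theorem slopeGsLJA2R_pieces (c w : (Fin 3 × Fin 3) ⊕ Fin 3 → ℤ) (J : Fin 3 → Fin 3 × Fin 3 → ℤ) (Lc Ln : List (Fin 3 → ℤ)) :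
    slopeGsLJA2R c w J Lc Ln = g0LJ c Lc + linLJA c w J Lc + quadL2R c w J Lc + rem3LJ c (hullW J w) Lc + naiSLJ c (hullW J w) Ln := rfl

/-- ★ **THE SLOPE INEQUALITY FROM PIECEWISE BOUNDS** (kernel: four separate `decide`s + one integer inequality). [formal bookkeeping] -/
theorem htGsSumA2R_of_pieces {p : HTCert} {J : Fin 3 → Fin 3 × Fin 3 → ℤ} {c w : (Fin 3 × Fin 3) ⊕ Fin 3 → ℤ} {b01 b2 b3 b4 : ℤ}
    (h01 : g0LJ c (htScA2F c w J (htNearU c w)) + linLJA c w J (htScA2F c w J (htNearU c w)) ≤ b01)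
    (h2 : quadL2R c w J (htScA2F c w J (htNearU c w)) ≤ b2)
    (h3 : rem3LJ c (hullW J w) (htScA2F c w J (htNearU c w)) ≤ b3)
    (h4 : naiSLJ c (hullW J w) (htSnA2F c w J (htNearU c w)) + htGsNA c w J (htFar1U c w) + htGsNA c w J (htFar2U c w) ≤ b4)
    (hsum : b01 + b2 + b3 + b4 ≤ p.Gs) : htGsSumA2R p J c w = true := by
  have e : htGsA2R c w J (htNearU c w) = g0LJ c (htScA2F c w J (htNearU c w)) + linLJA c w J (htScA2F c w J (htNearU c w)) +
      quadL2R c w J (htScA2F c w J (htNearU c w)) + rem3LJ c (hullW J w) (htScA2F c w J (htNearU c w)) + naiSLJ c (hullW J w) (htSnA2F c w J (htNearU c w)) :=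
    slopeGsLJA2R_pieces _ _ _ _ _
  simp only [htGsSumA2R, e, decide_eq_true_eq]
  omega

end Summit.AtomisticToContinuum.Crystallization.Theorems.FrustratedLawDichotomyStrainedPatchHomEntryLeafHT

end
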